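import Summits.CriticalPhenomena.PercolationContinuityZ3.Theorems.Transplant.FKDoubleFanOneSidedConeSFace
import HarnessLib

/-!
# Double fans `K₂ ∨ P_{m+1}`: SLICE-AFFINITY of the `a`-images in BOTH legs, and the `a`-spoke scaling of the rest

Helper file (`--supports stmt-CriticalPhenomena-4575`), FK sub-lane `prim-bschramm-fk-3` (gen 40); builds on p205010 (kernel theorem, internal audit
signed; external expert review pending).  Pure real algebra, no sorries; standard axioms.  Memo `bschramm/prim-bschramm-fk-3/FAR-CROSS-XV.md` §0(C2).

Structure lemmas behind the "extreme-family" reduction of memo XV, valid for ANY cone or functional statement that is linear in the atom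
`imgA q F w = Comb(F)ŵ ∧ Comb(F)P_aŵ`:
* **`imgA_gadget_slice`** — the gadget leg is AFFINE on the 3-planes `{F_ac+F_bc+F_1, F_0+F_ab fixed}`: if `G_ac+G_bc+G_1 = 0` and `G_0+G_ab = 0`
  then `imgA q (F + G) w = imgA q F w + Comb(G)ŵ ∧ Comb(F)P_aŵ` (the second factor `Comb(F)P_aŵ` sees `F` only through these two sums,
  **`fanCombo_pinA_slice`**); hence `imgA q G w = 0` for such `G` (**`imgA_slice_dir_eq_zero`**) and the midpoint identity **`imgA_slice_midpoint`**.
* **`imgA_rest_slice`** — the rest leg is AFFINE on `{ŷ, v̂ fixed}`: if `δ_0 + δ_ac = 0` and `|δ| = 0` then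
  `imgA q F (w + δ) = imgA q F w + Comb(F)δ̂ ∧ Comb(F)P_aŵ`.
* **`imgA_conv_edgeAC_rest`** — an `a`-spoke on the REST only rescales the atom: `imgA q F (AC_x ∗ w) = (1−x) • imgA q F w`
  (so `AB∗AC`-type rests carry the same rays as `AB`-letter rests).
Consequence (memo XV): cross-positivity / membership statements reduce to the extreme points of the slices of the valid body in both legs.
[folklore]
-/

noncomputable section

namespace Summit.CriticalPhenomena.PercolationContinuityZ3.Theorems

namespace FK

namespace ThreeApex

/-- On a gadget slice direction (`G_ac+G_bc+G_1 = 0`, `G_0+G_ab = 0`) the pinned factor does not move: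
`Comb(G)(P_a w) = 0`. [folklore] -/
theorem fanCombo_pinA_slice (q : ℝ) (G w : V5) (h1 : G.zac + G.zbc + G.z1 = 0) (h2 : G.z0 + G.zab = 0) :
    fanCombo q G (conv (edgeAC 1) w) = ⟨0, 0, 0, 0, 0⟩ := by
  have e1 : G.z1 = -G.zac - G.zbc := by linarith
  have e2 : G.zab = -G.z0 := by linarith
  ext <;> simp only [fanCombo, conv, edgeAC, detach, V5.total, e1, e2] <;> ring

/-- **Gadget-slice affinity.**  For a slice direction `G`: `imgA q (F + G) w = imgA q F w + Comb(G)ŵ ∧ Comb(F)P_aŵ`. [folklore] -/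
theorem imgA_gadget_slice (q : ℝ) (F G w : V5) (h1 : G.zac + G.zbc + G.z1 = 0) (h2 : G.z0 + G.zab = 0) :
    imgA q (V5.lin2 1 F 1 G) w =
      Biv.add (imgA q F w) (wedgeH (fanCombo q G (conv (edgeAC 0) w)) (fanCombo q F (conv (edgeAC 1) w))) := by
  have e1 : G.z1 = -G.zac - G.zbc := by linarith
  have e2 : G.zab = -G.z0 := by linarith
  simp only [imgA, V5.lin2, Biv.add, wedgeH, fanCombo, conv, edgeAC, detach, hx, hy, hz, V5.total, e1, e2]
  ext <;> ring

/-- A pure slice direction has zero image: `imgA q G w = 0` when `G_ac+G_bc+G_1 = 0 = G_0+G_ab`. [folklore] -/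
theorem imgA_slice_dir_eq_zero (q : ℝ) (G w : V5) (h1 : G.zac + G.zbc + G.z1 = 0) (h2 : G.z0 + G.zab = 0) :
    imgA q G w = ⟨0, 0, 0, 0, 0, 0, 0, 0, 0, 0⟩ := by
  have e1 : G.z1 = -G.zac - G.zbc := by linarith
  have e2 : G.zab = -G.z0 := by linarith
  simp only [imgA, wedgeH, fanCombo, conv, edgeAC, detach, hx, hy, hz, V5.total, e1, e2]
  ext <;> ring

/-- **Midpoint form of gadget-slice affinity**: for `F, F'` in the same slice (`F'_ac+F'_bc+F'_1 = F_ac+F_bc+F_1`, `F'_0+F'_ab = F_0+F_ab`),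
the image of the midpoint is the average of the images. [folklore] -/
theorem imgA_slice_midpoint (q : ℝ) (F F' w : V5) (h1 : F'.zac + F'.zbc + F'.z1 = F.zac + F.zbc + F.z1) (h2 : F'.z0 + F'.zab = F.z0 + F.zab) :
    imgA q (V5.lin2 (1 / 2) F (1 / 2) F') w = Biv.lin3 (1 / 2) (imgA q F w) (1 / 2) (imgA q F' w) 0 (imgA q F w) := by
  have e1 : F'.z1 = F.zac + F.zbc + F.z1 - F'.zac - F'.zbc := by linarith
  have e2 : F'.zab = F.z0 + F.zab - F'.z0 := by linarith
  simp only [imgA, V5.lin2, Biv.lin3, Biv.add, Biv.smul, wedgeH, fanCombo, conv, edgeAC, detach, hx, hy, hz, V5.total, e1, e2]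
  ext <;> ring

/-- **Rest-slice affinity.**  For a rest direction `δ` with `δ_0 + δ_ac = 0` and `|δ| = 0` (so `P_a` of the rest is unchanged):
`imgA q F (w + δ) = imgA q F w + Comb(F)δ̂ ∧ Comb(F)P_aŵ`. [folklore] -/
theorem imgA_rest_slice (q : ℝ) (F w δ : V5) (h1 : δ.z0 + δ.zac = 0) (h2 : δ.total = 0) :
    imgA q F (V5.lin2 1 w 1 δ) =
      Biv.add (imgA q F w) (wedgeH (fanCombo q F (conv (edgeAC 0) δ)) (fanCombo q F (conv (edgeAC 1) w))) := by
  have e1 : δ.zac = -δ.z0 := by linarith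
  have e2 : δ.z1 = -δ.z0 - δ.zab - δ.zac - δ.zbc := by have := h2; simp only [V5.total] at this; linarith
  simp only [imgA, V5.lin2, Biv.add, wedgeH, fanCombo, conv, edgeAC, detach, hx, hy, hz, V5.total, e1, e2]
  ext <;> ring

/-- **An `a`-spoke on the rest rescales the atom**: `imgA q F (AC_x ∗ w) = (1−x) • imgA q F w`. [folklore] -/
theorem imgA_conv_edgeAC_rest (q x : ℝ) (F w : V5) : imgA q F (conv (edgeAC x) w) = Biv.smul (1 - x) (imgA q F w) := by
  simp only [imgA, Biv.smul, wedgeH, fanCombo, conv, edgeAC, detach, hx, hy, hz, V5.total]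
  ext <;> ring

end ThreeApex

end FK

end Summit.CriticalPhenomena.PercolationContinuityZ3.Theorems
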